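import Mathlib
import HarnessLib
import HarnessLib.Audit
import Summits.CriticalPhenomena.Statement
import HarnessLib.Audit.Status.Attr

/-!
Route: PlanarCornerRotations

DORMANT since 2026-08-29T19:31:49Z (census g0: costume|duplicate of route-CriticalPhenomena-HyperoctahedralRP; reader census-reader-36-g0) — unstaffed, not closed; items shared with open routes are served there. `ledger route dormant <id> --off` reactivates.

# Route PlanarCornerRotations — rotations of the Z^3 limit from the solved dimension — planar
massive O(2) passes through the weak-interlayer corner; Stab(e3) plus cubic symmetry generate O(3)

It suffices to show X = (P) ∧ (CT) ∧ (Cub) ∧ (Gen) ∧ (C) ∧ (D) ∧ (E), realising card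
rotations-from-planar-corner for the ROTATION
half of clause (ii) and importing the rest. (P) PlanarMassiveIsotropy: every normalised
non-degenerate pointwise scaling limit of the
full-plane n-point spin correlations of the square-lattice Ising model in the massive
high-temperature window β = β_c(2) − mδ, m > 0,
is O(2)-invariant (the planar theorem: WMTB / Palmer–Tracy / SMJ scaling functions). (CT)
CornerTransfer — the card's L1–L3 in one
statement: GIVEN (P), every normalised, non-degenerate, translation-invariant, scale-covariant
pointwise scaling limit S of the critical
n.n. correlators on ℤ³ is invariant under every linear isometry fixing e₃ (Stab(e₃) ≅ O(2)_z);
mechanism: at the weak-interlayer corner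
(J,J,εJ), ε = g a^{7/4}, β_c(2) − β = m a, the lattice model converges to the layered continuum
theory T₀(m,g) on ℝ²×ℤ — independent
massive planar magnetisation fields tilted by exp(g Σ_k ∫Φ_kΦ_{k+1}) — which is EXACTLY
O(2)_z-invariant by (P), and the IR scaling
limits of critical T₀ are the cubic limits up to diag(1,1,c), which commutes with O(2)_z. (Cub)
LimitCubicSymmetry (support): every
normalised limit is invariant under the coordinate permutations (lattice automorphisms). (Gen)
AxesGenerateRotations (support):
Stab(e₃) ∪ {axis permutations} generates O(3). (C) ExistsScaleCovariantLimit, (D)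
InversionUpgradeNormalised, (E)
IsingEuclidUpgradeR4NonGaussian: existence without rotations, the inversion upgrade and U₄ ≢ 0 — the
verbatim shared items of route
HyperoctahedralRP / item 0636 (isotropy is OUTPUT here too, by a different engine).
Lean: `PlanarMassiveIsotropy ∧ CornerTransfer ∧ LimitCubicSymmetry ∧ AxesGenerateRotations ∧
ExistsScaleCovariantLimit ∧ InversionUpgradeNormalised ∧ IsingEuclidUpgradeR4NonGaussian`

## Assembly
Pure logic (theorem assembly_holds in the planner's Sketch.lean, lean check rc 0): take ρ, Δ, S from
ExistsScaleCovariantLimit (with its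
normalisation, non-degeneracy, translation invariance, scale covariance); CornerTransfer applied to
PlanarMassiveIsotropy (its antecedent
verbatim, definitional match) gives Stab(e₃)-invariance of S; LimitCubicSymmetry gives
axis-permutation invariance; AxesGenerateRotations
gives IsRotationInvariant S, hence IsEuclideanInvariant S := ⟨translations, rotations⟩;
InversionUpgradeNormalised gives
IsInversionCovariant Δ S; IsMoebiusCovariant Δ S := ⟨Euclid, scale, inversion⟩;
IsingEuclidUpgradeR4NonGaussian gives HasNontrivialU4 S;
conclude Ising3DConformalLimit (= Literature.Probability.LatticeModels.CritIsing3DConformalLimit,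
root-level abbrev).

Rationale: WHY THIS LINE. Rotation invariance of the critical ℤ³ limit is only postulated (DuminilCopinICM2022
§8.1 p.25) and every proved symmetry-enhancement
engine is planar (ChelkakHonglerIzyurovAnnals2015; LiouvilleRigidity). This line uses the solved
dimension as the SOURCE of 3D
symmetry: the cubic lattice contains three pencils of planes, and at the corner of the critical
surface where the interlayer coupling
ε → 0 each pencil is a stack of slightly massive planar Ising models whose scaling functions are
exactly O(2)-invariant (WuEtAl1976,
PalmerTracy1981, SchorOcarroll1982, Park2022, arXiv:1811.06636; fields and tails
CamiaGarbanNewman2015/2016, CamiaJiangNewman2020);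
dimensional crossover (LiuStanley1972 rigorous GKS bounds, LiuStanley1973, Cardy1996 PDF pp.56–58,
64–68, 72: φ = γ_2D = 7/4, shift
exponent 4/7, "anisotropy does not alter the critical behaviour") says the stack at its own critical
point is 3D Ising, so O(2)_z
should survive into every cubic scaling limit after the affine normalisation diag(1,1,c), which
commutes with it; cubic symmetry then
turns one axis into three and Stab(e₃) + permutations generate O(3) (Cartan–Dieudonné, Mathlib
reflections_generate). Imported areas:
planar exactly-solved/isomonodromic Ising theory (tau functions), constructive near-critical field
theory in d = 2, crossover scaling
(physics, with an explicit dictionary: crossover length ℓ(ε) = planar correlation length ξ₂(β_c(ε))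
≍ ε^{-4/7}), elementary Lie-group
generation. What it does that prior routes do not: HyperoctahedralRP gets isotropy from nine-mirror
reflection positivity + one-variable
analyticity; IsingEuclidUpgrade/IsingCFTData postulate it; here the typed crux (CT) is CONDITIONAL
on a planar theorem and its intended
proof runs through a constructible, UV-complete, exactly O(2)-symmetric intermediate object made of
Ising spins (T₀), with the d = 2
rehearsal of its universality half already a theorem (ChelkakIzyurovMahfouf2023: rhombic/anisotropic
lattices). Negatives index (SAW item
0772 only) is untouched.

RANKED CRUXES. #2 CornerTransfer (crux) — (card L1+L2+L3 compressed; the load-bearing step) IF every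
normalised non-degenerate pointwise scaling limit of the full-plane spin n-point functions
⟨∏σ_{[x_i/δ]}⟩⁺ of the square-lattice Ising model at β = β_c(2) − mδ (m > 0, renormalised by any ρ >
0 on (0,1]) is rotation invariant, THEN every pointwise scaling limit S of criticalCorr 3 (ρ > 0 on
(0,1]) that is normalised (S = 0 off NonCoincident), non-degenerate, translation invariant and scale
covariant with some Δ satisfies S n (R x₁,…,R xₙ) = S n (x) for every linear isometry R of ℝ³ with R
e₃ = e₃. Intended proof: layered continuum theory T₀(m,g) on ℝ²×ℤ (construction, exact O(2)_z from
the hypothesis, critical curve m_c(g) ≍ g^{4/7}), lattice → T₀ in the crossover window ε = g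
a^{7/4}, and corner universality: IR limits of critical T₀ = cubic limits ∘ diag(1,1,c). [deps:
PlanarMassiveIsotropy] [difficulty: open-problem] (why it might fail: Corner universality has no
engine beyond GKS monotonicity: IR limits of the exactly O(2)_z critical layered theory T₀ must
equal the cubic limits up to diag(1,1,c) — an exchange of limits (a→0 at ε = g a^{7/4} vs δ→0 at
fixed couplings) plus affine universality along the critical surface.) [LiuStanley1972,
LiuStanley1973, Cardy1996, CamiaGarbanNewman2016, CamiaJiangNewman2020, ChelkakIzyurovMahfouf2023,
Pelizzola1995, DuminilCopinICM2022]
#3 ExistsScaleCovariantLimit (crux) — (shared verbatim with route HyperoctahedralRP, item (C)) there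
are ρ > 0 on (0,1], Δ > 0 and S with HasPointwiseScalingLimit (criticalCorr 3) ρ S, S = 0 off
NonCoincident, IsNondegenerateTwoPoint S, IsTranslationInvariant S, IsScaleCovariant Δ S — existence
WITHOUT rotations (isotropy is output on this route). [difficulty: open-problem] (why it might fail:
Full δ→0⁺ convergence with ONE continuous Δ is open on ℤ³: only subsequential limits follow from the
two-point bounds c|x|⁻² ≤ G ≤ C|x|⁻¹, and RP/GKS two-point axiomatics admit log-periodic (discretely
scale covariant) profiles.) [DuminilCopinICM2022, arXiv:1912.07973, arXiv:2404.05700]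
#4 InversionUpgradeNormalised (crux) — (shared verbatim with route HyperoctahedralRP, item (D))
every pointwise scaling limit S of criticalCorr 3 (ρ > 0 on (0,1]) that is normalised,
non-degenerate, Euclidean invariant and scale covariant with Δ is inversion covariant with the same
Δ (Polyakov's upgrade, typed with the NonCoincident normalisation demanded by
Theorems/IsingEuclidUpgradeRefutations.lean). [difficulty: open-problem] (why it might fail: Scale +
RP + Euclid ⇏ Möbius in general (free Maxwell d = 3;
Literature.Barriers.CriticalPhenomena.ScaleCovarianceNotMoebius); for Ising it fails if the limit
carries a dimension-2 virial current or lacks a local stress tensor — excluded only numerically.)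
[DuminilCopinICM2022, PolandRychkovVichi2019, Polyakov1970]
#5 IsingEuclidUpgradeR4NonGaussian (crux) — (shared item stmt-CriticalPhenomena-0636, verbatim)
every non-degenerate pointwise scaling limit S of the renormalised critical Ising correlators on ℤ³
has connected four-point function U₄ ≢ 0 on non-coincident configurations (random-current
intersection identity; contrast d ≥ 4 triviality). [difficulty: open-problem] (why it might fail: No
proof that U₄ ≢ 0 in d = 3: the double-current intersection probability at macroscopic separation
must stay positive as δ → 0; RP long-range models on ℤ³ (α < 3/2) are Gaussian
(LongRangeTrivialityOnZ3).) [AizenmanDuminilCopinAnnals2021, DuminilCopinICM2022, Aizenman1982]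
#6 PlanarMassiveIsotropy (crux) — (the planar input of the card, filed explicitly; the hypothesis of
CornerTransfer verbatim) for every m > 0, every ρ > 0 on (0,1] and every family T on ℝ²: if ρ(δ)^n
⟨σ_{[x₁/δ]} ⋯ σ_{[xₙ/δ]}⟩⁺_{β_c(2) − mδ, 0} → T n (x) as δ → 0⁺ locally uniformly on non-coincident
configurations (full-plane plus state of the square-lattice Ising model, massive high-temperature
window), T = 0 off NonCoincident and T 2 > 0 off the diagonal, then T is invariant under every
linear isometry of ℝ² (the WMTB/Palmer–Tracy/SMJ scaling functions are Euclidean invariant; massive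
analogue of CHI Thm 1.2). [difficulty: M] (why it might fail: Likely KNOWN, but the T > T_c n-point
full-plane case must be located/assembled: convergence + Euclidean invariance of massive scaling
functions is printed for T < T_c (PalmerTracy1981, arXiv:1811.06636) and via OS axioms/SMJ tau
functions (SchorOcarroll1982, Palmer 2007).) [PalmerTracy1981, SchorOcarroll1982, WuEtAl1976,
Park2022, arXiv:1811.06636, CamiaGarbanNewman2016, MccoyWu1973]
#9 LimitCubicSymmetry (support) — every pointwise scaling limit S of criticalCorr 3 (ρ > 0 on (0,1])
that is normalised (S = 0 off NonCoincident) is invariant under every linear isometry P of ℝ³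
permuting the coordinate axes (∀ i ∃ j, P e_i = e_j): coordinate permutations commute exactly with
latticeApprox (coordinatewise floor) and leave criticalCorr 3 invariant (graph automorphism of ℤ³
preserving boxes and the + boundary condition: isingExpect_fixed_relabel, proved in tree; then
limUnder and uniqueness of limits on NonCoincident). [difficulty: provable-now] [FriedliVelenik2017,
ChelkakHonglerIzyurovAnnals2015]
#9 AxesGenerateRotations (support) — (card L4, pure group theory) for any S : CorrFamily 3,
invariance under every linear isometry fixing e₃ (Stab(e₃) ≅ O(2), reflections in vertical planes
included) and under every axis permutation implies IsRotationInvariant S (all of O(3)): the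
invariance set is a subgroup containing Stab(e₁), Stab(e₂) by conjugation, hence acts transitively
on S² and contains every hyperplane reflection s_v = g s_{e₁} g⁻¹; conclude by Cartan–Dieudonné
(Mathlib LinearIsometryEquiv.reflections_generate). [difficulty: provable-now]
[Mathlib:LinearIsometryEquiv.reflections_generate, FrancescoMathieuSenechal1997]

TWO-LAYER PLAN. Foreseen glued split of CornerTransfer (k = 3, depth 1), to be filed once the two
definition requests land (it cannot be typed before):
CornerTransfer ⇐ LayeredTheoryO2 → CrossoverWindowLimit → CornerUniversality → CornerTransfer, where
LayeredTheoryO2 (card L1) = an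
instance of the layered corner theory T₀(m,g) on ℝ²×ℤ exists for all small g > 0 (independent
massive planar magnetisation fields tilted
by exp(g Σ_k ∫Φ_kΦ_{k+1}); exponential moments from CGN-type tails; FKG/GKS; infinite stack), is
exactly O(2)_z-invariant given
PlanarMassiveIsotropy, and has a sharp critical curve m_c(g) ≍ g^{4/7}; CrossoverWindowLimit (card
L2) = the anisotropic lattice model
with couplings (1,1,ε), ε = g a^{7/4}, β = β_c(2) − m a, converges (n-point functions × a^{-n/8}) to
T₀(m,g) locally uniformly, and
β_c(ε(a)) ↔ m_c(g); CornerUniversality (card L3, the real crux) = every normalised admissible cubic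
limit S equals, after diag(1,1,c) and a
constant, a pointwise IR scaling limit of critical T₀. Support children foreseen:
CornerCriticalCurve (card L0: β_c(ε) ↑ β_c(2) continuously
as ε ↓ 0 with window bounds c ε^{4/7+o(1)} ≤ β_c(2) − β_c(ε) ≤ C ε^{4/7−o(1)}; lower half from the
exactly known planar γ = 7/4 and GKS,
LiuStanley1972) and the d = 2 rehearsal (weakly coupled critical chains / rhombic lattices: affine
universality is ChelkakIzyurovMahfouf2023).
PlanarMassiveIsotropy, if not simply known: ⇐ two-point (Toeplitz/WMTB) → n-point (Pfaffian/SMJ), k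
= 2.

KILL CRITERIA. CornerTransfer can only be refuted as typed by a normalised admissible cubic limit
that is not Stab(e₃)-invariant, i.e. by ¬(rotation
invariance on ℤ³) — that kills clause (ii) and every route of the conjunct alike (close
refuted:CornerTransfer, file the witness as a
negative). The LINE dies earlier and more cheaply if (a) corner universality fails: the critical
layered theory T₀ flows in the IR to
something other than the cubic fixed point ∘ diag(1,1,c) (numerical signature below), or the
anisotropic critical models are shown not to
be affine images of the cubic one (flux-quadrupole-stress-tensor n = 2 test) — then close exhausted
with census and leave isotropy to
HyperoctahedralRP; (b) the bilayer tilt exp(g∫Φ₁Φ₂) has no exponential moments for the massive CGN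
field (L1 dead ⇒ no T₀; pivot to a
lattice-regularised layered theory or close). PlanarMassiveIsotropy refuted in substance is
physically impossible (WMTB); refuted through a
typing technicality (junk values of plusExpect, floor conventions) ⇒ restate both it and
CornerTransfer's antecedent 1:1. Refutation of
ExistsScaleCovariantLimit / InversionUpgradeNormalised / IsingEuclidUpgradeR4NonGaussian is shared
fate with HyperoctahedralRP,
IsingEuclidUpgrade, IsingCFTData. If HyperoctahedralRP proves LimitRotationInvariant first, this
route is superseded for the assembly but
CornerTransfer stays wanted as an independent mechanism.

NOT DECOMPOSED YET. Everything inside CornerTransfer (the three children above and L0) —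
deliberately, because the children need two notions Lean lacks
(anisotropic plus state; layered corner theory interface) and D-0019 earns depth after
definitions/first closures; the identification of
the full-plane plus-state limit with CHI's bulk limit at m = 0 (not needed: m > 0 only);
tightness/continuity inputs of
ExistsScaleCovariantLimit (shared); any use of the layer-reversal symmetry k ↦ −k (not needed:
Stab(e₃) + permutations already generate
O(3)); constants c(ε) of the affine normalisation.

CHEAPEST FALSIFIER. (1) Lookup, decides rank 6: is the T > T_c (disordered) massive n-point scaling
limit of full-plane square-lattice spin correlations with
Euclidean-invariant limit printed as a theorem (Palmer, Planar Ising Correlations 2007, SMJ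
chapters; SchorOcarroll1982 OS axioms;
PalmerTracy1981 is T < T_c; Park2022/arXiv:1811.06636)? Not held here (lit search: zbMATH/crossref
only this session; OpenAlex/arXiv/S2
rate-limited) — a grounder with the book settles it. (2) Kit numerics, kills the line: Wolff-cluster
MC of the anisotropic model (1,1,ε) at
β_c(ε) for ε ∈ {1, 0.3, 0.1} on L ≤ 128: the in-plane four-fold anisotropy coefficient a₄(r) of
⟨σ₀σ_x⟩ (axis vs diagonal at equal |x|,
r ≫ ℓ(ε) ≍ ε^{-4/7}) must be SUPPRESSED relative to the cubic model at equal r/ℓ by ≍ ε^{8/7}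
(planar T T̄ descendant, dimension 4,
has already died at the crossover scale); no suppression ⇒ the corner does not deliver in-plane
isotropy faster than the bulk and the
mechanism is empty. (3) Bilayer: two CGN massive fields, does E exp(g∫_Λ Φ₁Φ₂) < ∞ follow from the
exp(−c|t|^{16}) tails
(CamiaGarbanNewman2016)? A one-page computation; failure kills L1.

NUMBERS. β_c(2) = ½ log(1+√2) = 0.4406868; β_c(3) = 0.22165463(8) (MC); Δ_σ = 1/8 (d = 2, CHI), Δ_σ
≈ 0.5181489 (d = 3, bootstrap); crossover
exponent φ = γ_2D = 7/4, shift exponent 1/φ = 4/7 (LiuStanley1972/1973; verified numerically for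
coupled planes, Pelizzola1995,
doi:10.1016/j.physa.2019.123276); planar lattice-anisotropy (T T̄) irrelevance exponent 2; rigorous
ℤ³ window 1/2 ≤ Δ ≤ 1
(scalingDimension_mem_Icc_holds). Items at open: 8 (5 cruxes, 2 support, 1 assembly).

DEFINITION REQUESTS. D1 (Literature/Probability/LatticeModels) `anisoPlusExpect d (J : Fin d → ℝ) (β
h : ℝ)`: the plus state of the n.n. Ising model on ℤ^d
with axis-dependent couplings (Hamiltonian −Σ_i J_i Σ_x σ_xσ_{x+e_i} − hΣσ_x) as a limit functional
along boxes (shape of plusExpect;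
via gibbsSpecOfPotential or a weighted isingMeasure), with anisoCorr d J β : LatticeCorrFamily d and
anisoCriticalBeta d J := sInf {β ≥ 0 |
⟨σ₀⟩⁺ > 0}; needed for CrossoverWindowLimit, CornerCriticalCurve and the affine-universality half of
CornerUniversality. D2
(Summits/CriticalPhenomena/Ising3DConformalLimit/Theorems, posited object) `LayeredCornerTheory (g :
ℝ)`: an INTERFACE (structure) for
the critical layered corner theory — a family T : (n : ℕ) → (Fin n → EuclideanSpace ℝ (Fin 2) × ℤ) →
ℝ with in-plane O(2) invariance,
layer-translation invariance, positivity/Griffiths-type axioms and its provenance clause (joint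
limit of anisoCorr 3 (1,1,g a^{7/4}) at
β_c(2) − m_c(g) a, renormalised by a^{-n/8}); existence is NOT part of the interface (it is the
child LayeredTheoryO2). Cite fact wanted:
"massive scaling functions of planar Ising spin correlations are Euclidean invariant"
(PalmerTracy1981 Thm; Palmer 2007) — would turn
PlanarMassiveIsotropy into `(h : Fact) →`.

Novelty: Searches (2026-08-15): `lit search --source zbmath "massive scaling limit Ising correlations"` (9:
PalmerTracy1981-adjacent, Park2022,
arXiv:1811.06636, ChelkakIzyurovMahfouf2023), `… "Palmer Tracy two-dimensional Ising correlations
scaling limit"` (2), `… --source crossref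
"massive scaling limit Ising model subcritical isomonodromy"` (8: SchorOcarroll1982, Its–Novokshenov
1986), `… zbmath "planar Ising
magnetization field near-critical"` (4: CamiaJiangNewman2020, CJN review arXiv:2009.08129), `…
crossref "dimensional crossover lattice
anisotropy Ising weakly coupled layers Liu Stanley"` (10: LiuStanley1972 rigorous, LiuStanley1973,
Chang–Stanley 1973, Basaiawmoit–Singh
1983), `… crossref "infinitely many coupled Ising planes transition temperature shift"`
(Pelizzola1995 + reply), `… crossref "coupled
two-dimensional Ising layers conformal field theory flow three-dimensional Ising"` (10, none joining
layered 2D CFTs to 3D symmetry),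
`… zbmath "coupled conformal field theories layers three-dimensional Ising"` (0), `lit galaxy search
"coupled Ising planes" | "dimensional
crossover" | "weakly coupled Ising layers …" --star all` (0 rows; galaxy pdf star queued-out), `lit
frontier CriticalPhenomena --since 2020`
(30 rows: planar SLE/CLE, lace expansion, arXiv:2604.05772 percolation in 3D Ising — none on ℤ³
isotropy), `lit bridges CriticalPhenomena
--cross any` (surveys only), Cardy1996 held copy re-read PDF pp.56–58, 64–68, 72; OpenAlex/arXiv/S2
HTTP 429 and local searchd reset th  [refs: 10.1016/j.physa.2019.123276., 10.1016/0375-9601(72, 1811.06636, 2009.08129, 2604.05772, doi:10.1016/j.physa.2019.123276., doi:10.1016/0375-9601, PalmerTracy1981, Park2022, ChelkakIzyurovMahfouf2023, SchorOcarroll1982, CamiaJiangNewman2020, LiuStanley1972, LiuStanley1973, Pelizzola1995, Cardy1996]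

Barriers (technique_class: dimensional-crossover, planar-theorem-import): - technique_class: dimensional-crossover, planar-theorem-import
- Literature.Barriers.CriticalPhenomena.LiouvilleRigidity: respected — only the GLOBAL O(2) content
of the planar theorems crosses into d = 3 (inside CornerTransfer's hypothesis); no conformal map,
s-holomorphicity or Virasoro is used in ℝ³.
- Literature.Barriers.CriticalPhenomena.ScaleCovarianceNotMoebius: not engaged by the new crux
(rotations only); the inversion step is the shared item InversionUpgradeNormalised, typed with
HasPointwiseScalingLimit (criticalCorr 3) + NonCoincident normalisation, the model-specific form the
barrier and Theorems/IsingEuclidUpgradeRefutations.lean leave open.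
- Literature.Barriers.CriticalPhenomena.BootstrapLatticeBlindness: evaded — every object is a
lattice Ising state or a constructive continuum field made of Ising spins; no CFT data enter.
- Literature.Barriers.CriticalPhenomena.RigorousRGSmallParameter: it does not evade it; the bet is
that ε (equivalently g) is needed as a small parameter only in the UV, where the layers are solved
planar models, while the IR of T₀ is reached by a universality statement (CornerUniversality), not
by a perturbative RG — the strongly coupled fixed point is never expanded around.
- Literature.Barriers.CriticalPhenomena.SlabLimitUniformControl: applies in spirit (percolation
entry: slab facts do not pass to ℤ³ without width-uniform control) — here stacks are infinite in the
stacking direction at every stage and the small parameter is a coupling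

History (route lifecycle, newest last):
- 2026-08-25T04:36:46Z · DORMANT — reconciler: no traction for 7.4 d (last activity item-evidence-added at 2026-08-17T19:00:39Z); parked, not closed — `ledger route dormant route-CriticalPhenomen (operator:999:2988609)
- 2026-08-27T13:31:40Z · REACTIVATED — reconciler: reactivated — activity statement-claimed at 2026-08-27T11:07:20Z after parking at 2026-08-25T04:36:46Z (operator:999:2926895)
- 2026-08-29T19:31:49Z · DORMANT — census g0: costume|duplicate of route-CriticalPhenomena-HyperoctahedralRP; reader census-reader-36-g0 (operator:999:1153119)

sub-problem: Ising3DConformalLimit · status: dormant · opened planner-plancard-CriticalPhenomena-Ising3DCon-0893da44-0 2026-08-15T11:34:41Z · rev 2 · ledger route-CriticalPhenomena-PlanarCornerRotations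
GENERATED by the gate from the ledger (D-0016/17). Provers cite these decls: `theorem foo : Summit.CriticalPhenomena.Ising3DConformalLimit.Theses.PlanarCornerRotations.<Decl> := …` in Summits/CriticalPhenomena/Ising3DConformalLimit/Theorems/<Name>.lean.
-/

namespace Summit.CriticalPhenomena.Ising3DConformalLimit.Theses.PlanarCornerRotations

open scoped BigOperators Topology Manifold Classical MeasureTheory ProbabilityTheory Matrix InnerProductSpace ComplexConjugate ContinuousMap
open Filter Set Function TopologicalSpace MeasureTheory

attribute [summit_statement] _root_.Ising3DConformalLimit

/-- item stmt-CriticalPhenomena-4631 · crux · rank 2 · open · by planner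
why it might fail: As typed = Stab(e₃)-isotropy of every admissible ℤ³ limit, open (DuminilCopinICM2022 §8.1 p.40: rotations only postulated); the corner engine has no tool beyond GKS for the exchange a→0 at ε = g·a^{7/4} vs δ→0 at fixed ε: IR limits of the O(2)_z layered theory T₀ need not be cubic ∘ diag(1,1,c).
sources: DuminilCopinICM2022, LiuStanley1972, LiuStanley1973, Cardy1996, ChelkakIzyurovMahfouf2023, Pelizzola1995
[crux] (card L1+L2+L3 compressed; the load-bearing step) IF every normalised non-degenerate
pointwise scaling limit of the full-plane spin n-point functions ⟨∏σ_{[x_i/δ]}⟩⁺ of the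
square-lattice Ising model at β = β_c(2) − mδ (m > 0, renormalised by any ρ > 0 on (0,1]) is
rotation invariant, THEN every pointwise scaling limit S of criticalCorr 3 (ρ > 0 on (0,1]) that is
normalised (S = 0 off NonCoincident), non-degenerate, translation invariant and scale covariant with
some Δ satisfies S n (R x₁,…,R xₙ) = S n (x) for every linear isometry R of ℝ³ with R e₃ = e₃.
Intended proof: layered continuum theory T₀(m,g) on ℝ²×ℤ (construction, exact O(2)_z from the
hypothesis, critical curve m_c(g) ≍ g^{4/7}), lattice → T₀ in the crossover window ε = g a^{7/4},
and corner universality: IR limits of critical T₀ = cubic limits ∘ diag(1,1,c). [deps: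
PlanarMassiveIsotropy] [difficulty: open-problem] -/
@[route_item "route-CriticalPhenomena-PlanarCornerRotations", crux]
def CornerTransfer : Prop :=
  (∀ m : ℝ, 0 < m → ∀ (ρ : ℝ → ℝ) (T : Literature.Probability.LatticeModels.CorrFamily 2), (∀ δ ∈ Set.Ioc (0:ℝ) 1, 0 < ρ δ) → (∀ n, TendstoLocallyUniformlyOn (fun (δ : ℝ) (x : Fin n → EuclideanSpace ℝ (Fin 2)) => ρ δ ^ n * Literature.Probability.LatticeModels.plusExpect 2 (Literature.Probability.LatticeModels.criticalBeta 2 - m * δ) 0 (Literature.Probability.LatticeModels.spinMonomial fun i => Literature.Probability.LatticeModels.latticeApprox δ (x i))) (T n) (nhdsWithin (0:ℝ) (Set.Ioi 0)) (Literature.Probability.LatticeModels.NonCoincident 2 n)) → (∀ n z, z ∉ Literature.Probability.LatticeModels.NonCoincident 2 n → T n z = 0) → Literature.Probability.LatticeModels.IsNondegenerateTwoPoint T → Literature.Probability.LatticeModels.IsRotationInvariant T) → ∀ (ρ : ℝ → ℝ) (Δ : ℝ) (S : Literature.Probability.LatticeModels.CorrFamily 3), (∀ δ ∈ Set.Ioc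 (0:ℝ) 1, 0 < ρ δ) → Literature.Probability.LatticeModels.HasPointwiseScalingLimit (Literature.Probability.LatticeModels.criticalCorr 3) ρ S → (∀ n z, z ∉ Literature.Probability.LatticeModels.NonCoincident 3 n → S n z = 0) → Literature.Probability.LatticeModels.IsNondegenerateTwoPoint S → Literature.Probability.LatticeModels.IsTranslationInvariant S → Literature.Probability.LatticeModels.IsScaleCovariant Δ S → ∀ (R : EuclideanSpace ℝ (Fin 3) ≃ₗᵢ[ℝ] EuclideanSpace ℝ (Fin 3)), R (EuclideanSpace.single 2 1) = EuclideanSpace.single 2 1 → ∀ n (x : Fin n → EuclideanSpace ℝ (Fin 3)), S n (fun i => R (x i)) = S n x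

/-- item stmt-CriticalPhenomena-1981 · crux · rank 3 · SPLIT (gen 1) into TwoPointDoubling, ClusterSetTotallyDisconnected + glue ExistsScaleCovariantLimitOfSubs · direct attempts still welcome (low priority) · by planner
why it might fail: Full δ→0⁺ convergence with ONE continuous Δ is open on ℤ³ (DuminilCopinICM2022 §8, PDF p.48 'widely open'): only subsequential limits follow from the two-point bounds c|x|⁻² ≤ G ≤ C|x|⁻¹ (arXiv:2404.05700), and RP/GKS two-point axiomatics admit log-periodic (discretely scale-covariant) profiles.
sources: DuminilCopinICM2022, arXiv:1912.07973, arXiv:2404.05700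
[crux r4, (C), existence WITHOUT rotations] There are ρ > 0 on (0,1], Δ > 0 and S with
HasPointwiseScalingLimit (criticalCorr 3) ρ S, S = 0 off NonCoincident, IsNondegenerateTwoPoint S,
IsTranslationInvariant S, IsScaleCovariant Δ S. Strictly weaker than CritIsing3DEuclideanLimit (item
0638: rotations included) — on this route isotropy is OUTPUT. Inputs in tree:
criticalTwoPoint_bounds_holds (c|x|⁻² ≤ G ≤ C|x|⁻¹ ⇒ subsequential limits, Δ ∈ [1/2,1]); missing:
uniqueness/full-filter convergence and continuous scale covariance (DuminilCopinICM2022 §8.4 p.29: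
'widely open'). -/
@[route_item "route-CriticalPhenomena-PlanarCornerRotations", crux]
def ExistsScaleCovariantLimit : Prop :=
  ∃ (ρ : ℝ → ℝ) (Δ : ℝ) (S : Literature.Probability.LatticeModels.CorrFamily 3), (∀ δ ∈ Set.Ioc (0:ℝ) 1, 0 < ρ δ) ∧ 0 < Δ ∧ Literature.Probability.LatticeModels.HasPointwiseScalingLimit (Literature.Probability.LatticeModels.criticalCorr 3) ρ S ∧ (∀ n z, z ∉ Literature.Probability.LatticeModels.NonCoincident 3 n → S n z = 0) ∧ Literature.Probability.LatticeModels.IsNondegenerateTwoPoint S ∧ Literature.Probability.LatticeModels.IsTranslationInvariant S ∧ Literature.Probability.LatticeModels.IsScaleCovariant Δ S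

/-- item stmt-CriticalPhenomena-1982 · crux · rank 4 · open · by planner
why it might fail: Scale + RP + Euclid ⇏ Möbius in general (free Maxwell d = 3; Literature.Barriers.CriticalPhenomena.ScaleCovarianceNotMoebius_holds, proved in tree); for Ising it fails if the limit carries a dimension-2 virial current or lacks a local stress tensor — excluded only numerically (bootstrap), unproved.
sources: Polyakov1970, PolandRychkovVichi2019, DuminilCopinICM2022, Literature.Barriers.CriticalPhenomena.ScaleCovarianceNotMoebius_holds
[crux r5, (D), inversion upgrade re-typed] Every pointwise scaling limit S of criticalCorr 3 (ρ > 0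
on (0,1]) that is normalised (S = 0 off NonCoincident), non-degenerate, Euclidean invariant and
scale covariant with Δ is IsInversionCovariant Δ (hence Möbius). This is (U) of route
IsingEuclidUpgrade (item 0637, refuted AS TYPED by not_inversionUpgrade_of_euclideanLimit through
values on the coincident locus) with the normalisation hypothesis the refutation file prescribes;
the model-blind version is false (Literature.Barriers.CriticalPhenomena.ScaleCovarianceNotMoebius;
free Maxwell d=3, ElshowkNakayamaRychkov2011), so any proof must use the Ising hypothesis (RP +
locality / absence of a dimension-2 virial current: DelamotteTissierWschebor2016 §5–6,
Nakayama2015). -/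
@[route_item "route-CriticalPhenomena-PlanarCornerRotations", crux]
def InversionUpgradeNormalised : Prop :=
  ∀ (ρ : ℝ → ℝ) (Δ : ℝ) (S : Literature.Probability.LatticeModels.CorrFamily 3), (∀ δ ∈ Set.Ioc (0:ℝ) 1, 0 < ρ δ) → Literature.Probability.LatticeModels.HasPointwiseScalingLimit (Literature.Probability.LatticeModels.criticalCorr 3) ρ S → (∀ n z, z ∉ Literature.Probability.LatticeModels.NonCoincident 3 n → S n z = 0) → Literature.Probability.LatticeModels.IsNondegenerateTwoPoint S → Literature.Probability.LatticeModels.IsEuclideanInvariant S → Literature.Probability.LatticeModels.IsScaleCovariant Δ S → Literature.Probability.LatticeModels.IsInversionCovariant Δ S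

/-- item stmt-CriticalPhenomena-0636 · crux · rank 5 · open · by planner
why it might fail: No proof that U₄ ≢ 0 in d = 3: the double-current intersection probability at macroscopic separation must stay positive as δ → 0 (arXiv:1912.07973 eq. (3.11) is only the identity); RP long-range models on ℤ³ with α < 3/2 ARE Gaussian (Literature.Barriers.CriticalPhenomena.LongRangeTrivialityOnZ3).
sources: AizenmanDuminilCopinAnnals2021, arXiv:1912.07973, Aizenman1982, DuminilCopinICM2022, Literature.Barriers.CriticalPhenomena.LongRangeTrivialityOnZ3
Crux r4 (non-triviality in d=3): every non-degenerate pointwise scaling limit S of the renormalised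
critical Ising correlators on Z^3 has connected four-point function U4 ≢ 0 on non-coincident
configurations. Intended tool: the random-current identity U4(x,y,z,t) =
−2⟨σxσy⟩⟨σzσt⟩·P^{xy,zt}[C_{n1+n2}(x) ∩ C_{n1+n2}(z) ≠ ∅] (Aizenman 1982; ADC2021 arXiv:1912.07973
eq. (3.11)): non-Gaussianity ⇔ the intersection probability of the two double-current clusters at
macroscopic separation does not vanish as δ → 0. Contrast: for d ≥ 4 every such limit IS Gaussian
(Literature.Probability.LatticeModels.highDim_triviality). Its negation refutes the conjunct
Ising3DConformalLimit itself. -/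
@[route_item "route-CriticalPhenomena-PlanarCornerRotations", crux]
def IsingEuclidUpgradeR4NonGaussian : Prop :=
  ∀ (ρ : ℝ → ℝ) (S : Literature.Probability.LatticeModels.CorrFamily 3), (∀ δ ∈ Set.Ioc (0:ℝ) 1, 0 < ρ δ) → Literature.Probability.LatticeModels.HasPointwiseScalingLimit (Literature.Probability.LatticeModels.criticalCorr 3) ρ S → Literature.Probability.LatticeModels.IsNondegenerateTwoPoint S → Literature.Probability.LatticeModels.HasNontrivialU4 S

/-- item stmt-CriticalPhenomena-4632 · support · rank 6 · open · by planner
why it might fail: Likely KNOWN, but the T > T_c n-point full-plane case must be located/assembled: convergence + Euclidean invariance of massive scaling functions is printed for T < T_c (PalmerTracy1981, arXiv:1811.06636) and via OS axioms/SMJ tau functions (SchorOcarroll1982, Palmer 2007).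
sources: SatoMiwaJimbo1980, WuEtAl1976, arXiv:1811.06636, Palmer2007, SchorOcarroll1982, PalmerTracy1981
[crux] (the planar input of the card, filed explicitly; the hypothesis of CornerTransfer verbatim)
for every m > 0, every ρ > 0 on (0,1] and every family T on ℝ²: if ρ(δ)^n ⟨σ_{[x₁/δ]} ⋯
σ_{[xₙ/δ]}⟩⁺_{β_c(2) − mδ, 0} → T n (x) as δ → 0⁺ locally uniformly on non-coincident configurations
(full-plane plus state of the square-lattice Ising model, massive high-temperature window), T = 0
off NonCoincident and T 2 > 0 off the diagonal, then T is invariant under every linear isometry of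
ℝ² (the WMTB/Palmer–Tracy/SMJ scaling functions are Euclidean invariant; massive analogue of CHI Thm
1.2). [difficulty: M] -/
@[route_item "route-CriticalPhenomena-PlanarCornerRotations", crux]
def PlanarMassiveIsotropy : Prop :=
  ∀ m : ℝ, 0 < m → ∀ (ρ : ℝ → ℝ) (T : Literature.Probability.LatticeModels.CorrFamily 2), (∀ δ ∈ Set.Ioc (0:ℝ) 1, 0 < ρ δ) → (∀ n, TendstoLocallyUniformlyOn (fun (δ : ℝ) (x : Fin n → EuclideanSpace ℝ (Fin 2)) => ρ δ ^ n * Literature.Probability.LatticeModels.plusExpect 2 (Literature.Probability.LatticeModels.criticalBeta 2 - m * δ) 0 (Literature.Probability.LatticeModels.spinMonomial fun i => Literature.Probability.LatticeModels.latticeApprox δ (x i))) (T n) (nhdsWithin (0:ℝ) (Set.Ioi 0)) (Literature.Probability.LatticeModels.NonCoincident 2 n)) → (∀ n z, z ∉ Literature.Probability.LatticeModels.NonCoincident 2 n → T n z = 0) → Literature.Probability.LatticeModels.IsNondegenerateTwoPoint T → Literature.Probability.LatticeModels.IsRotationInvariant T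

/-- item stmt-CriticalPhenomena-4633 · support · rank 9 · open · by planner
sources: FriedliVelenik2017, ChelkakHonglerIzyurovAnnals2015
[support] every pointwise scaling limit S of criticalCorr 3 (ρ > 0 on (0,1]) that is normalised (S =
0 off NonCoincident) is invariant under every linear isometry P of ℝ³ permuting the coordinate axes
(∀ i ∃ j, P e_i = e_j): coordinate permutations commute exactly with latticeApprox (coordinatewise
floor) and leave criticalCorr 3 invariant (graph automorphism of ℤ³ preserving boxes and the +
boundary condition: isingExpect_fixed_relabel, proved in tree; then limUnder and uniqueness of
limits on NonCoincident). [difficulty: provable-now] -/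
@[route_item "route-CriticalPhenomena-PlanarCornerRotations", crux]
def LimitCubicSymmetry : Prop :=
  ∀ (ρ : ℝ → ℝ) (S : Literature.Probability.LatticeModels.CorrFamily 3), (∀ δ ∈ Set.Ioc (0:ℝ) 1, 0 < ρ δ) → Literature.Probability.LatticeModels.HasPointwiseScalingLimit (Literature.Probability.LatticeModels.criticalCorr 3) ρ S → (∀ n z, z ∉ Literature.Probability.LatticeModels.NonCoincident 3 n → S n z = 0) → ∀ (P : EuclideanSpace ℝ (Fin 3) ≃ₗᵢ[ℝ] EuclideanSpace ℝ (Fin 3)), (∀ i : Fin 3, ∃ j : Fin 3, P (EuclideanSpace.single i 1) = EuclideanSpace.single j 1) → ∀ n (x : Fin n → EuclideanSpace ℝ (Fin 3)), S n (fun i => P (x i)) = S n x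

/-- item stmt-CriticalPhenomena-4634 · support · rank 9 · open · by planner
sources: Mathlib:LinearIsometryEquiv.reflections_generate, FrancescoMathieuSenechal1997
[support] (card L4, pure group theory) for any S : CorrFamily 3, invariance under every linear
isometry fixing e₃ (Stab(e₃) ≅ O(2), reflections in vertical planes included) and under every axis
permutation implies IsRotationInvariant S (all of O(3)): the invariance set is a subgroup containing
Stab(e₁), Stab(e₂) by conjugation, hence acts transitively on S² and contains every hyperplane
reflection s_v = g s_{e₁} g⁻¹; conclude by Cartan–Dieudonné (Mathlib
LinearIsometryEquiv.reflections_generate). [difficulty: provable-now] -/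
@[route_item "route-CriticalPhenomena-PlanarCornerRotations", crux]
def AxesGenerateRotations : Prop :=
  ∀ (S : Literature.Probability.LatticeModels.CorrFamily 3), (∀ (R : EuclideanSpace ℝ (Fin 3) ≃ₗᵢ[ℝ] EuclideanSpace ℝ (Fin 3)), R (EuclideanSpace.single 2 1) = EuclideanSpace.single 2 1 → ∀ n (x : Fin n → EuclideanSpace ℝ (Fin 3)), S n (fun i => R (x i)) = S n x) → (∀ (P : EuclideanSpace ℝ (Fin 3) ≃ₗᵢ[ℝ] EuclideanSpace ℝ (Fin 3)), (∀ i : Fin 3, ∃ j : Fin 3, P (EuclideanSpace.single i 1) = EuclideanSpace.single j 1) → ∀ n (x : Fin n → EuclideanSpace ℝ (Fin 3)), S n (fun i => P (x i)) = S n x) → Literature.Probability.LatticeModels.IsRotationInvariant S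

-- item stmt-CriticalPhenomena-5127 · support · rank 9 · open · by planner — informal only, no Lean statement yet:
--   [support] CornerCriticalCurve (card L0; needs definition request anisoCriticalBeta/anisoPlusExpect,
--   hence informal until it lands): for the n.n. Ising model on ℤ³ with couplings (1,1,ε), ε ≥ 0, the
--   critical inverse temperature β_c(ε) := anisoCriticalBeta 3 (1,1,ε) is non-increasing in ε (GKS),
--   satisfies β_c(ε) < β_c(2) for ε > 0 (Aizenman–Grimmett-type strictness / GKS comparison with the
--   decoupled stack) and β_c(ε) ↑ β_c(2) = ½ log(1+√2) as ε ↓ 0 (uniqueness and exponential decay of the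
--   massive layers survive a small ferromagnetic interlayer perturbation); quantitative crossover
--   window: c ε^{

/-- item stmt-CriticalPhenomena-4635 · assembly · rank 1 · open · by planner
sources: DuminilCopinICM2022, ChelkakHonglerIzyurovAnnals2015
[assembly] PlanarMassiveIsotropy → CornerTransfer → LimitCubicSymmetry → AxesGenerateRotations →
ExistsScaleCovariantLimit → InversionUpgradeNormalised → IsingEuclidUpgradeR4NonGaussian →
Ising3DConformalLimit. -/
@[route_item "route-CriticalPhenomena-PlanarCornerRotations"]
def Assembly : Prop :=
  PlanarMassiveIsotropy → CornerTransfer → LimitCubicSymmetry → AxesGenerateRotations → ExistsScaleCovariantLimit → InversionUpgradeNormalised → IsingEuclidUpgradeR4NonGaussian → Ising3DConformalLimit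

/-! D-0027 §2.1 — DECIDING THEOREM (planner-authored via `route open/edit --closes-file`; by planner-rbadge-CriticalPhenomena-PlanarCornerR-760ea82c-g4-0 2026-08-15T16:11:45Z):
its hypotheses are this route's items and its conclusion the sub-problem Statement (glue_lint), and it elaborates with this file. -/

@[closes "route-CriticalPhenomena-PlanarCornerRotations"] theorem closes (hP : PlanarMassiveIsotropy) (hCT : CornerTransfer)
    (hCub : LimitCubicSymmetry) (hGen : AxesGenerateRotations)
    (hC : ExistsScaleCovariantLimit) (hD : InversionUpgradeNormalised)
    (hE : IsingEuclidUpgradeR4NonGaussian) : _root_.Ising3DConformalLimit := by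
  obtain ⟨ρ, Δ, S, hρ, hΔ, hlim, hnorm, hnd, htr, hsc⟩ := hC
  have hstab := hCT hP ρ Δ S hρ hlim hnorm hnd htr hsc
  have hperm := hCub ρ S hρ hlim hnorm
  have hrot : Literature.Probability.LatticeModels.IsRotationInvariant S := hGen S hstab hperm
  have heuc : Literature.Probability.LatticeModels.IsEuclideanInvariant S := ⟨htr, hrot⟩
  have hinv : Literature.Probability.LatticeModels.IsInversionCovariant Δ S :=
    hD ρ Δ S hρ hlim hnorm hnd heuc hsc
  exact ⟨ρ, Δ, S, hρ, hΔ, hlim, hnd, ⟨heuc, hsc, hinv⟩, hE ρ S hρ hlim hnd⟩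

end Summit.CriticalPhenomena.Ising3DConformalLimit.Theses.PlanarCornerRotations
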